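import Literature.NumberTheory.GaloisCohomology.Howard2004.SelmerTriples
import Mathlib.LinearAlgebra.Basis.Basic
import Mathlib.RingTheory.LocalRing.Basic
import HarnessLib

/-!
# Principal Artinian coefficient rings: ideals are powers of `π`, and the injective morphisms of `Quot(T)`
# are unit multiples of `×π^{j-i}` (theorems only; no definition, no named fact, no `sorry`)

B. Howard, *The Heegner point Kolyvagin system*, Compositio Math. 140 (2004) (arXiv:1202.6340).  Rem. 1.1.4
(p. 5 L100–105): «Of special interest is the case where `R` is principal and Artinian of length `k` … Let
`𝔪 = πR` be the maximal ideal of `R`» — typed `Howard2004.IsPrincipalArtinianOfLength R k` (`SelmerTriples.lean`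
§A; discharged for the Eisenstein level rings `A_{m,k} = S_𝔮/π^{mk}` by
`IwasawaAlgebra.EisensteinCoeff.isPrincipalArtinianOfLength`).  Def. 1.1.3 (p. 5 L93–99): the category `Quot(T)`
has objects `T/IT` (`I` an ideal of `R`) and morphisms `T/IT → T/JT` «induced by scalar multiplications `r ∈ R` with
`rI ⊂ J`» (tree `IsQuotMorphism`).  Over such an `R` both are explicit, which is what reduces Howard's H.3
(«cartesian on `Quot(T)`», all objects and all injective morphisms) to the `π`-power maps (companion file
`QuotCartesianReductionProofs`):

* §1 (`R` local, `𝔪 = (π)`, `π^n = 0`): `exists_unit_mul_pow_or_mem_span_pow`, **`exists_unit_mul_pow_eq`** (every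
  `r = u·π^s`, `u` a unit, `s ≤ n`), **`ideal_eq_span_pow`** (every ideal is `(π^i)` with `i ≤ n`),
  `pow_ne_zero_of_lt` / **`le_of_pow_mem_span_pow`** (`π^a ∈ (π^i)` with `a < n` forces `i ≤ a` when `π^{n-1} ≠ 0`),
  and the two unpackings of `IsPrincipalArtinianOfLength` (`pow_eq_zero_of_…`, `pow_pred_ne_zero_of_…`).
* §2 (`T` free over `R`, H.0): `smul_basis_mem_smul_top_iff` (`c • b i ∈ I·T ↔ c ∈ I`),
  `le_of_pow_smul_basis_mem`, and **`exists_unit_eq_mul_pow_of_injective`**: for presentations `π_I : T ↠ N` with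
  kernel `π^iT` (`1 ≤ i ≤ n`) and `π_J : T ↠ N'` with kernel `π^jT` (`j ≤ n`), an INJECTIVE additive `f` with
  `f ∘ π_I = r · π_J` forces `i ≤ j` and `r = u · π^{j-i}` (`u` a unit); `eq_smul_of_comp_eq` (`f = u · g` for the
  canonical `g = ×π^{j-i}`).

Everything is [folklore] commutative algebra recorded against Howard's Rem. 1.1.4 / Def. 1.1.3.  Cell `pub/bsd-print-x9`,
shared μ-item of rows 9/10 (D1 road, `SatisfiesH.h3`); seat `bsd-line-x10b-p1-w6`.  BSD is not proved by any of this.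
-/

set_option autoImplicit false

noncomputable section

open Function

namespace Literature.NumberTheory.GaloisCohomology.Howard2004

/-! ## §1 Principal Artinian local rings: elements and ideals are powers of `π` -/

section Ring

variable {R : Type} [CommRing R] {π : R} {n : ℕ}

/-- If `π^{n-1} ≠ 0` then `π^a ≠ 0` for every `a < n`. [cite: Howard2004HeegnerKolyvagin, Rem. 1.1.4 (arXiv Rem. 2.1.4, p. 5 L100–105: R of length k)] -/
theorem pow_ne_zero_of_lt (hn' : n ≠ 0 → π ^ (n - 1) ≠ 0) {a : ℕ} (ha : a < n) : π ^ a ≠ 0 := by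
  intro h
  apply hn' (by omega)
  rw [show n - 1 = a + (n - 1 - a) by omega, pow_add, h, zero_mul]

variable [IsLocalRing R]

/-- In a local ring with `𝔪 = (π)`: every element is `u · π^s` with `u` a unit and `s < k`, or lies in `π^k R`.
[cite: Howard2004HeegnerKolyvagin, Rem. 1.1.4 (arXiv Rem. 2.1.4, p. 5 L100–105: R principal Artinian, 𝔪 = πR)] -/
theorem exists_unit_mul_pow_or_mem_span_pow (hmax : IsLocalRing.maximalIdeal R = Ideal.span {π}) (k : ℕ) (r : R) :
    (∃ (s : ℕ) (u : Rˣ), s < k ∧ r = u * π ^ s) ∨ ∃ r' : R, r = π ^ k * r' := by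
  induction k with
  | zero => exact Or.inr ⟨r, by rw [pow_zero, one_mul]⟩
  | succ k ih =>
    rcases ih with ⟨s, u, hs, hr⟩ | ⟨r', hr'⟩
    · exact Or.inl ⟨s, u, Nat.lt_succ_of_lt hs, hr⟩
    · by_cases hu : IsUnit r'
      · exact Or.inl ⟨k, hu.unit, Nat.lt_succ_self k, by rw [hr', IsUnit.unit_spec, mul_comm]⟩
      · have hm : r' ∈ IsLocalRing.maximalIdeal R := hu
        rw [hmax, Ideal.mem_span_singleton'] at hm
        obtain ⟨r'', rfl⟩ := hm
        exact Or.inr ⟨r'', by rw [hr', pow_succ]; ring⟩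

/-- **Every element of a principal Artinian local ring is a unit times a power of `π`**: `r = u · π^s` with
`s ≤ n`, where `𝔪 = (π)` and `π^n = 0` (for `r = 0` take `s = n`).
[cite: Howard2004HeegnerKolyvagin, Rem. 1.1.4 (arXiv Rem. 2.1.4, p. 5 L100–105)] -/
theorem exists_unit_mul_pow_eq (hmax : IsLocalRing.maximalIdeal R = Ideal.span {π}) (hn : π ^ n = 0) (r : R) :
    ∃ (s : ℕ) (u : Rˣ), s ≤ n ∧ r = u * π ^ s := by
  rcases exists_unit_mul_pow_or_mem_span_pow hmax n r with ⟨s, u, hs, hr⟩ | ⟨r', hr'⟩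
  · exact ⟨s, u, hs.le, hr⟩
  · exact ⟨n, 1, le_rfl, by rw [hr', hn, zero_mul, Units.val_one, one_mul]⟩

/-- **Every ideal of a principal Artinian local ring is a power of the maximal ideal**: `I = (π^i)` with `i ≤ n`
(so the objects `T/IT` of `Quot(T)` are the `T/π^iT`, `0 ≤ i ≤ n`).
[cite: Howard2004HeegnerKolyvagin, Rem. 1.1.4 and Def. 1.1.3 (arXiv p. 5 L93–105)] -/
theorem ideal_eq_span_pow (hmax : IsLocalRing.maximalIdeal R = Ideal.span {π}) (hn : π ^ n = 0) (I : Ideal R) :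
    ∃ i : ℕ, i ≤ n ∧ I = Ideal.span {π ^ i} := by
  classical
  have hex : ∃ s : ℕ, s ≤ n ∧ π ^ s ∈ I := ⟨n, le_rfl, by rw [hn]; exact I.zero_mem⟩
  refine ⟨Nat.find hex, (Nat.find_spec hex).1, le_antisymm ?_ ?_⟩
  · intro r hr
    obtain ⟨s, u, hs, rfl⟩ := exists_unit_mul_pow_eq hmax hn r
    have hsI : π ^ s ∈ I := by
      have := I.mul_mem_left ((u⁻¹ : Rˣ) : R) hr
      rwa [← mul_assoc, Units.inv_mul, one_mul] at this
    have hle : Nat.find hex ≤ s := Nat.find_min' hex ⟨hs, hsI⟩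
    rw [Ideal.mem_span_singleton']
    exact ⟨u * π ^ (s - Nat.find hex), by rw [mul_assoc, ← pow_add, Nat.sub_add_cancel hle]⟩
  · rw [Ideal.span_le, Set.singleton_subset_iff]
    exact (Nat.find_spec hex).2

/-- **`π^a ∈ (π^i)` with `a < n` forces `i ≤ a`** in a principal Artinian local ring of length `n` (`𝔪 = (π)`,
`π^{n-1} ≠ 0`): otherwise `π^a (1 - cπ^{i-a}) = 0` with `1 - cπ^{i-a}` a unit.
[cite: Howard2004HeegnerKolyvagin, Rem. 1.1.4 (arXiv p. 5 L100–105)] -/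
theorem le_of_pow_mem_span_pow (hmax : IsLocalRing.maximalIdeal R = Ideal.span {π})
    (hn' : n ≠ 0 → π ^ (n - 1) ≠ 0) {a i : ℕ} (ha : a < n) (h : π ^ a ∈ Ideal.span {π ^ i}) : i ≤ a := by
  rcases Nat.lt_or_ge a i with hlt | hle
  · exfalso
    rw [Ideal.mem_span_singleton'] at h
    obtain ⟨c, hc⟩ := h
    have hπ : π ∈ IsLocalRing.maximalIdeal R := by rw [hmax]; exact Ideal.mem_span_singleton_self π
    have hunit : IsUnit (1 - c * π ^ (i - a)) := by
      apply IsLocalRing.isUnit_one_sub_self_of_mem_nonunits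
      rw [← IsLocalRing.mem_maximalIdeal]
      exact Ideal.mul_mem_left _ _ (Ideal.pow_mem_of_mem _ hπ _ (by omega))
    have hzero : π ^ a * (1 - c * π ^ (i - a)) = 0 := by
      rw [mul_sub, mul_one, mul_left_comm, ← pow_add, show a + (i - a) = i by omega, hc, sub_self]
    exact pow_ne_zero_of_lt hn' ha ((hunit.mul_left_eq_zero).mp hzero)
  · exact hle

/-- From `IsPrincipalArtinianOfLength R n` and `𝔪 = (π)`: `π^n = 0`.
[cite: Howard2004HeegnerKolyvagin, Rem. 1.1.4 (arXiv p. 5 L100–105)] -/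
theorem pow_eq_zero_of_isPrincipalArtinianOfLength (hP : IsPrincipalArtinianOfLength R n)
    (hmax : IsLocalRing.maximalIdeal R = Ideal.span {π}) : π ^ n = 0 := by
  have h := hP.pow_eq_bot
  rw [hmax, Ideal.span_singleton_pow, Ideal.span_singleton_eq_bot] at h
  exact h

/-- From `IsPrincipalArtinianOfLength R n` and `𝔪 = (π)`: `π^{n-1} ≠ 0` (for `n ≠ 0`).
[cite: Howard2004HeegnerKolyvagin, Rem. 1.1.4 (arXiv p. 5 L100–105)] -/
theorem pow_pred_ne_zero_of_isPrincipalArtinianOfLength (hP : IsPrincipalArtinianOfLength R n)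
    (hmax : IsLocalRing.maximalIdeal R = Ideal.span {π}) (h0 : n ≠ 0) : π ^ (n - 1) ≠ 0 := by
  have h := hP.pow_pred_ne_bot (Nat.pos_of_ne_zero h0)
  rw [hmax, Ideal.span_singleton_pow, Ne, Ideal.span_singleton_eq_bot] at h
  exact h

end Ring

/-! ## §2 Free modules: the injective `Quot`-morphisms out of a non-zero object -/

section Free

variable {R : Type} [CommRing R] {M : Type} [AddCommGroup M] [Module R M]
  {N : Type} [AddCommGroup N] [Module R N] {N' : Type} [AddCommGroup N'] [Module R N']

/-- For a basis vector `b i` of a free module: `c • b i ∈ I · T ↔ c ∈ I` (read off the `i`-th coordinate).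
[cite: Howard2004HeegnerKolyvagin, H.0 and Def. 1.1.3 (arXiv p. 7 L57; p. 5 L93–99: the quotients T/IT of a free T)] -/
theorem smul_basis_mem_smul_top_iff {ι : Type*} (b : Module.Basis ι R M) (i : ι) (I : Ideal R) (c : R) :
    c • b i ∈ I • (⊤ : Submodule R M) ↔ c ∈ I := by
  constructor
  · intro h
    have hmap : (b.coord i) (c • b i) ∈ (I • (⊤ : Submodule R M)).map (b.coord i) :=
      Submodule.mem_map_of_mem h
    have hc : (b.coord i) (c • b i) = c := by simp [b.repr_self]
    rw [hc, Submodule.map_smul''] at hmap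
    have hle : I • ((⊤ : Submodule R M).map (b.coord i)) ≤ (I : Submodule R R) :=
      Submodule.smul_le.mpr fun r hr x _ => I.mul_mem_right x hr
    exact hle hmap
  · intro hc
    exact Submodule.smul_mem_smul hc Submodule.mem_top

/-- `T` free over `R` with `𝔪 = (π)`, `π^{n-1} ≠ 0`: `π^a • e ∈ π^i · T` for a basis vector `e` and `a < n` forces
`i ≤ a`. [cite: Howard2004HeegnerKolyvagin, H.0 and Rem. 1.1.4 (arXiv p. 7 L57, p. 5 L100–105)] -/
theorem le_of_pow_smul_basis_mem [IsLocalRing R] {π : R} {n : ℕ}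
    (hmax : IsLocalRing.maximalIdeal R = Ideal.span {π}) (hn' : n ≠ 0 → π ^ (n - 1) ≠ 0)
    {ι : Type*} (b : Module.Basis ι R M) (i₀ : ι) {a i : ℕ} (ha : a < n)
    (h : π ^ a • b i₀ ∈ Ideal.span {π ^ i} • (⊤ : Submodule R M)) : i ≤ a :=
  le_of_pow_mem_span_pow hmax hn' ha ((smul_basis_mem_smul_top_iff b i₀ _ _).mp h)

/-- **Classification of the injective morphisms of `Quot(T)` out of a non-zero object** (`T` free over the
principal Artinian local ring `R`, `𝔪 = (π)`, `π^n = 0 ≠ π^{n-1}`): if `π_I : T ↠ N` has kernel `π^iT` with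
`1 ≤ i ≤ n`, `π_J : T ↠ N'` has kernel `π^jT` with `j ≤ n`, and an injective additive `f : N → N'` satisfies
`f ∘ π_I = r · π_J` (Def. 1.1.3: «the maps induced by scalar multiplications `r ∈ R` with `rI ⊂ J`»), then `i ≤ j`
and `r = u · π^{j-i}` for a unit `u`.  Proof: `r = uπ^s`; `π^i e ∈ ker π_I` gives `π^{s+i} e ∈ π^jT`, so
`j ≤ s + i`; `π^{j-s} e` is killed by `r · π_J`, so by injectivity `π^{j-s} e ∈ π^iT`, whence `i ≤ j - s`.
[cite: Howard2004HeegnerKolyvagin, Def. 1.1.2–1.1.3 and Rem. 1.1.4 (arXiv p. 5 L88–105)] -/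
theorem exists_unit_eq_mul_pow_of_injective [IsLocalRing R] [Module.Free R M] [Nontrivial M] {π : R} {n : ℕ}
    (hmax : IsLocalRing.maximalIdeal R = Ideal.span {π}) (hn : π ^ n = 0) (hn' : n ≠ 0 → π ^ (n - 1) ≠ 0)
    {i j : ℕ} (hi : 1 ≤ i) (hin : i ≤ n) (hjn : j ≤ n)
    {πI : M →ₗ[R] N} (hkerI : LinearMap.ker πI = Ideal.span {π ^ i} • (⊤ : Submodule R M))
    {πJ : M →ₗ[R] N'} (hkerJ : LinearMap.ker πJ = Ideal.span {π ^ j} • (⊤ : Submodule R M))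
    {r : R} {f : N →+ N'} (hf : ∀ m : M, f (πI m) = r • πJ m) (hinj : Function.Injective f) :
    i ≤ j ∧ ∃ u : Rˣ, r = u * π ^ (j - i) := by
  obtain ⟨s, u, hs, rfl⟩ := exists_unit_mul_pow_eq hmax hn r
  let b := Module.Free.chooseBasis R M
  obtain ⟨i₀⟩ := b.index_nonempty
  -- a basis vector times `π^c` lies in `ker π_J` as soon as `j ≤ c`
  have hkerJ_of_le : ∀ c : ℕ, j ≤ c → π ^ c • b i₀ ∈ LinearMap.ker πJ := fun c hc => by
    rw [hkerJ]
    refine Submodule.smul_mem_smul ?_ Submodule.mem_top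
    rw [Ideal.mem_span_singleton']
    exact ⟨π ^ (c - j), by rw [← pow_add, Nat.sub_add_cancel hc]⟩
  -- (1) `j ≤ s + i`
  have h1 : j ≤ s + i := by
    rcases Nat.lt_or_ge (s + i) j with hlt | hle
    · exfalso
      have hker : π ^ i • b i₀ ∈ LinearMap.ker πI := by
        rw [hkerI]; exact Submodule.smul_mem_smul (Ideal.mem_span_singleton_self _) Submodule.mem_top
      have h0 : ((u : R) * π ^ s) • πJ (π ^ i • b i₀) = 0 := by
        rw [← hf, LinearMap.mem_ker.mp hker, map_zero]
      have hmem : π ^ (s + i) • b i₀ ∈ LinearMap.ker πJ := by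
        rw [LinearMap.mem_ker, pow_add, mul_smul, map_smul, map_smul]
        have h0' := congrArg (fun x => ((u⁻¹ : Rˣ) : R) • x) h0
        simp only [smul_zero, ← mul_smul, ← mul_assoc, Units.inv_mul, one_mul] at h0'
        rw [map_smul] at h0'
        exact h0'
      rw [hkerJ] at hmem
      have := le_of_pow_smul_basis_mem hmax hn' b i₀ (lt_of_lt_of_le hlt hjn) hmem
      omega
    · exact hle
  -- (2) `i ≤ j - s`
  have h2 : i ≤ j - s := by
    rcases Nat.lt_or_ge (j - s) n with hlt | hle
    · have hzero : ((u : R) * π ^ s) • πJ (π ^ (j - s) • b i₀) = 0 := by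
        have hmem := hkerJ_of_le (s + (j - s)) (by omega)
        rw [LinearMap.mem_ker, pow_add, mul_smul, map_smul] at hmem
        rw [mul_smul, hmem, smul_zero]
      have hI : πI (π ^ (j - s) • b i₀) = 0 := by
        apply hinj
        rw [hf, hzero, map_zero]
      have hmem : π ^ (j - s) • b i₀ ∈ Ideal.span {π ^ i} • (⊤ : Submodule R M) := by
        rw [← hkerI]; exact hI
      exact le_of_pow_smul_basis_mem hmax hn' b i₀ hlt hmem
    · exact le_trans hin hle
  refine ⟨by omega, u, ?_⟩
  rw [show j - i = s by omega]

/-- Under the conclusion of the classification, `f` is the unit `u` times any additive `g` with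
`g ∘ π_I = π^d · π_J` (on all of `N`, `π_I` being onto). [cite: Howard2004HeegnerKolyvagin, Def. 1.1.3 (arXiv p. 5 L93–99)] -/
theorem eq_smul_of_comp_eq {πI : M →ₗ[R] N} (hsurj : Function.Surjective πI) {πJ : M →ₗ[R] N'}
    {u : Rˣ} {d : ℕ} {π : R} {f g : N →+ N'} (hf : ∀ m : M, f (πI m) = ((u : R) * π ^ d) • πJ m)
    (hg : ∀ m : M, g (πI m) = π ^ d • πJ m) (x : N) : f x = (u : R) • g x := by
  obtain ⟨m, rfl⟩ := hsurj x
  rw [hf, hg, mul_smul]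

end Free

end Literature.NumberTheory.GaloisCohomology.Howard2004

end
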